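import Literature.MathematicalPhysics.QuantumFieldTheory.BalabanImbrieJaffe1984to88.BIJ88Eq532Torus

/-!
# `BalabanImbrieJaffe1984to88.BIJ88Eq531SmallAPrime` — T. Bałaban, J. Imbrie, A. Jaffe, *Effective action and cluster properties of the
abelian Higgs model*, Commun. Math. Phys. **114** (1988) 257–315 [BalabanImbrieJaffe1988], p. 280, the sentence after **(5.3.1)**:
*"Using the restrictions |u(p) − 1| ≦ e_kp(e_k) in Λ₀^{(k)**}, and the axial gauge conditions, we obtain that u′_b = e^{ie_kA′_b} with
|A′_b| ≦ cp(e_k), for b ∈ Λ₁^{(k)*}."* — PROVED on the torus carrier of record, one renormalization step, with the constant `c = c(d, L)`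
explicit, for the objects of record: the axial gauge `δ_{Ax}` of (3.11) (r18's `BIJ88RenormTransf311.DeltaAx`, the corner comb trees), the
block average `v = Qu` of [BalabanImbrieJaffe1985] (2.10)–(2.11) (r18's `BIJ85BlockAveragesTorus.qU`, branch `argB ∈ [−π, π)`), and the
translated field `u′ = u·(Q^{s*}v)^{−1}` of (3.24)/(5.3.1) = [BalabanImbrieJaffe1985] (3.9) (r18's `BIJ85BlockAveragesTorus.uPrime`).

statement-level skeleton of published theorems with citation tags; proofs where landed; nothing here is a claim about the Yang–Mills mass gap

PDF held: `paper:balaban1988-cmp114-bij-abelian-higgs-effective-action` (journal page = PDF page + 256), p. 280 [PDF 24] read as the image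
`HOME/lit-balaban-r16/renders/cmp114/original-p024-x2.png` (this seat, gen 5); [BalabanImbrieJaffe1985]
(`paper:balaban1985-cmp97-bij-higgs-minimizers`, journal page = PDF + 298) pp. 302–307 [PDF 4–9] ((2.4), (2.10)–(2.11), (3.4), (3.9)–(3.11))
read by this seat in gens 3–5.

CITATION HEADER (lean-in-tree rule).  Part of the lit-balaban TYPED SKELETON (HOME `run/shared/lean/pub/lit-balaban/`), PHASE-2 proof
seat p31 gen 5 (unit `lit-balaban-p31-g5`), file 4 of the gen after `BIJ88Eq536Linearization` (p252131), `BIJ88Eq537Jacobian` (p252614),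
`BIJ88Eq532Torus` (p253053).  WHAT IS REPRODUCED: row **C2.Eq5.3.1-5.3.7** (owner r16, `BIJ88Sect5StatementsPart3`): the smallness
*"|A′_b| ≦ cp(e_k)"* which r16 could only STATE as the predicate `BIJ88Sect5StatementsPart3.SmallAPrime c pek Λ₁* A′` is here DERIVED from
the restrictions on the plaquette variables and the axial gauge, exactly as the sentence says, with `c = 6d²L²` (sharper:
`c = N₁(4N₁ + L + 1)`, `N₁ = (d−1)(L−1)`); rows **C2.Eq3.24** (r18) and **C1.Eq3.9-3.12** (r15) use the same objects.

THE ARGUMENT (the paper gives none beyond the sentence; this is the standard one, cf. [Balaban1985Averaging] Prop. 1 for the non-abelian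
box version filed as `Balaban1983to89.T4AxialGaugeSmallField`).  Write `a(b) = argB u_b ∈ [−π, π)` and assume `|argB u(∂p)| ≤ ε` on the
plaquettes of the two blocks `B(y)`, `B(y + e_μ)` met by a bond, `δ_{Ax}(u)`: `u_b = 1` on the comb trees.
* §3 INTERIOR BONDS (`b = ⟨x, x + e_μ⟩ ⊂ B(y)`): `|a(b)| ≤ (Σ_{κ<μ} r_κ)·ε ≤ N₁ε`, `r` the offsets of `x` in `B(y)` — induction on
  `Σ_{κ<μ} r_κ`: lowering the lowest non-zero offset `κ₀ < μ` of `x` crosses ONE plaquette `⟨x − e_{κ₀}; κ₀, μ⟩` whose two `κ₀`-bonds are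
  tree bonds (`interior_bound`).
* §4 SURFACE BONDS (`b = ⟨x, x + e_μ⟩`, `x` on the face `r_μ = L − 1` of `B(y)`), compared with the face bond ON THE CORNER LINE
  `b* = ⟨yL + (L−1)e_μ, yL + Le_μ⟩` (the last bond of `Γ_{y,y+e_μ}`): `|argB(u_b u_{b*}^{−1})| ≤ (Σ_{κ≠μ} r_κ)(1 + 2N₁)ε ≤ N₂ε`,
  `N₂ = N₁(1 + 2N₁)` — each transverse step crosses one plaquette and two interior bonds, one in each block (`surface_bound`).
* §5 THE AVERAGE (2.10) IN THE AXIAL GAUGE: `u(Γ_{y,y′}) = u_{b*}`, the loop through `x ∈ B(y)` is `u(Γ_{x,x′})u_{b*}^{−1}` = (`L − 1`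
  interior bonds) × (`u_{b_x}u_{b*}^{−1}`, `b_x` the surface bond on the line of `x`), so `|argB(loop_x)| ≤ N₃ε`, `N₃ = (L−1)N₁ + N₂`, hence
  `|L^{−d}Σ_x argB(loop_x)| ≤ N₃ε` and **`(Qu)_{yy′} = u_{b*}·exp(i·L^{−d}Σ_x argB loop_x)`** (`toC_qU_of_deltaAx`, `abs_loopAvg_le`).
* §6 THE TRANSLATED FIELD `u′ = u(Q^{s*}Qu)^{−1}`: on a surface bond `u′_b = (u_bu_{b*}^{−1})·e^{−iL^{−d}Σ…}`, on an interior bond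
  `u′_b = u_b`; so **`|argB u′_b| ≤ (N₂ + N₃)ε = N₁(4N₁ + L + 1)ε ≤ 6d²L²ε`** for every bond whose two blocks carry the plaquette
  restriction (`abs_argB_uPrime_le`, `abs_argB_uPrime_le_six`), i.e. **`u′_b = e^{ie_kA′_b}`, `|A′_b| ≤ c·p(e_k)`** with `ε = e_kp(e_k)`,
  `A′_b = argB(u′_b)/e_k` — r16's `SmallAPrime (6d²L²) p(e_k) Λ₁* A′` DISCHARGED from plaquette restrictions on the blocks met by `Λ₁*`
  (`smallAPrime_of_plaquettes`), and `u′ = BIJ88Sect5StatementsPart3.uPrime e_k A′` (`toC_uPrime_eq_uPrime531`).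
* §0 is the branch-(2.11) toolkit on the unit circle (`argB(zw) = argB z + argB w` when `|argB z| + |argB w| < π`, `|argB z^{−1}| = |argB z|`,
  `|argB z| ≤ (π/2)|z − 1|` converting the printed restriction `|u(p) − 1| ≦ e_kp(e_k)`); all smallness hypotheses are `(constant)·ε < π`,
  which is what makes the branch additive along the combs.
Standing hypotheses: `j + 1 ≤ m + K` (block geometry of `Setup`).  No `def`s, no new `def … : Prop`.  Axioms: {propext, Classical.choice,
Quot.sound}.  Unit `lit-balaban-p31` gen 5 (literature-prover-lit-balaban-p31-g5-0), 2026-08-21.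
-/

namespace Literature.MathematicalPhysics.QuantumFieldTheory.BalabanImbrieJaffe1984to88.BIJ88Eq531SmallAPrime

open Literature.MathematicalPhysics.QuantumFieldTheory.Balaban1983to89
open BIJ88Sect3Statements (U1 toC toC_mul toC_one norm_toC cfg)
open BIJ88Sect3Rescaling (toC_injective_U1)
open BIJ85Sect1Model (argB argB_mem_Ico)
open BIJ85SmallFieldSplit64 (argB_exp_mul_I argB_eq_arg)
open BIJ88RenormTransf311 (inBlock IsAxialBond axialBonds mem_axialBonds DeltaAx)
open BIJ85CurlQsstar (shift_blockSite_of_lt shift_blockSite_of_eq)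
open BIJ85BlockAveragesTorus
open GaugeField (plaqHol)
open scoped BigOperators Real
open Complex Finset

noncomputable section

variable {P : Params} {j : ℕ}

-- The constants (natural numbers; local notations, expanded in every statement):
-- `N₁ = (d−1)(L−1)` — the largest number of plaquettes between an interior bond and the comb tree of its block;
-- `N₂ = N₁(1 + 2N₁)` — the constant of the surface bonds; `N₃ = (L−1)N₁ + N₂` — the constant of the loops of (2.10);
-- the constant of the sentence is `c = N₂ + N₃ = N₁(4N₁ + L + 1) ≤ 6d²L²`.
local notation "N₁" => ((P.d - 1) * (P.L - 1) : ℕ)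
local notation "N₂" => ((P.d - 1) * (P.L - 1) * (1 + 2 * ((P.d - 1) * (P.L - 1))) : ℕ)
local notation "N₃" => ((P.L - 1) * ((P.d - 1) * (P.L - 1)) + (P.d - 1) * (P.L - 1) * (1 + 2 * ((P.d - 1) * (P.L - 1))) : ℕ)

/-! ## §0  The branch (2.11) on the unit circle -/

/-- kernel: `|argB z| ≤ π` (the printed range `−π ≦ arg ln u < π`). [cite: BalabanImbrieJaffe1985, (2.11) p.303] -/
theorem abs_argB_le_pi (z : ℂ) : |argB z| ≤ π :=
  abs_le.2 ⟨(argB_mem_Ico z).1, (argB_mem_Ico z).2.le⟩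

/-- kernel: `argB 1 = 0`. [cite: BalabanImbrieJaffe1985, (2.11) p.303] -/
private theorem argB_one_eq_zero : argB 1 = 0 := by
  have h := argB_exp_mul_I (t := 0) ⟨by linarith [Real.pi_pos], Real.pi_pos⟩
  simpa using h

/-- kernel: a unit complex number is the exponential of its branch-(2.11) logarithm, `z = exp(i·argB z)`.
[cite: BalabanImbrieJaffe1985, (2.11) p.303] -/
theorem exp_argB_mul_I_of_norm {z : ℂ} (hz : ‖z‖ = 1) : Complex.exp (argB z * I) = z := by
  have hmain : Complex.exp (Complex.arg z * I) = z := by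
    have h := Complex.norm_mul_exp_arg_mul_I z
    rwa [hz, Complex.ofReal_one, one_mul] at h
  by_cases h : Complex.arg z = π
  · rw [argB, if_pos h, ← hmain, h]
    push_cast
    rw [neg_mul, Complex.exp_neg, Complex.exp_pi_mul_I]
    norm_num
  · rw [argB_eq_arg h, hmain]

/-- kernel: `argB(e^{it}) = t` for `|t| < π`. [cite: BalabanImbrieJaffe1985, (2.11) p.303] -/
theorem argB_exp_of_abs_lt {t : ℝ} (ht : |t| < π) : argB (Complex.exp (t * I)) = t :=
  argB_exp_mul_I ⟨(abs_lt.1 ht).1.le, (abs_lt.1 ht).2⟩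

/-- **The branch (2.11) is additive on small phases**: `argB(zw) = argB z + argB w` for unit `z, w` with `|argB z| + |argB w| < π` (no
winding as long as the total phase stays inside `(−π, π)` — the mechanism behind every use of *"|u(p) − 1| ≦ e_kp(e_k) … and the axial
gauge conditions"*). [cite: BalabanImbrieJaffe1985, (2.11) p.303] -/
theorem argB_mul_of_norm {z w : ℂ} (hz : ‖z‖ = 1) (hw : ‖w‖ = 1) (h : |argB z| + |argB w| < π) :
    argB (z * w) = argB z + argB w := by
  have e : Complex.exp (((argB z + argB w : ℝ) : ℂ) * I) = z * w := by
    rw [ofReal_add, add_mul, Complex.exp_add, exp_argB_mul_I_of_norm hz, exp_argB_mul_I_of_norm hw]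
  rw [← e, argB_exp_of_abs_lt (lt_of_le_of_lt (abs_add_le _ _) h)]

/-- kernel: the quantitative form — `|argB(zw)| ≤ s + t` if `|argB z| ≤ s`, `|argB w| ≤ t`, `s + t < π`. [cite: BalabanImbrieJaffe1985, (2.11) p.303] -/
theorem abs_argB_mul_le {z w : ℂ} (hz : ‖z‖ = 1) (hw : ‖w‖ = 1) {s t : ℝ} (hs : |argB z| ≤ s) (ht : |argB w| ≤ t)
    (hst : s + t < π) : |argB (z * w)| ≤ s + t := by
  rw [argB_mul_of_norm hz hw (by linarith)]
  exact (abs_add_le _ _).trans (add_le_add hs ht)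

/-- kernel: **`|argB z^{−1}| = |argB z|`** on the unit circle (`u_{b^{−1}} = u_b^{−1}`; at `z = −1` both sides are `π`).
[cite: BalabanImbrieJaffe1985, (2.11) p.303] -/
theorem abs_argB_inv {z : ℂ} (hz : ‖z‖ = 1) : |argB z⁻¹| = |argB z| := by
  have e : z⁻¹ = Complex.exp (((-argB z : ℝ) : ℂ) * I) := by
    rw [ofReal_neg, neg_mul, Complex.exp_neg, exp_argB_mul_I_of_norm hz]
  rcases eq_or_lt_of_le (argB_mem_Ico z).1 with h | h
  · rw [e, ← h, neg_neg]
    have h2 : Complex.exp ((π : ℝ) * I) = Complex.exp (((-π : ℝ) : ℂ) * I) := by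
      rw [ofReal_neg, neg_mul, Complex.exp_neg, Complex.exp_pi_mul_I]
      norm_num
    rw [h2, argB_exp_mul_I ⟨le_rfl, by linarith [Real.pi_pos]⟩]
  · rw [e, argB_exp_of_abs_lt (by rw [abs_neg]; exact abs_lt.2 ⟨h, (argB_mem_Ico z).2⟩), abs_neg]

/-- kernel: a unit bond variable read in `ℂ` times the inverse of another is a unit complex number. [cite: BalabanImbrieJaffe1985, (2.5) p.302] -/
private theorem norm_toC_mul_inv (g h : U1) : ‖toC g * (toC h)⁻¹‖ = 1 := by
  rw [norm_mul, norm_inv, norm_toC, norm_toC, inv_one, mul_one]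

/-- **The printed restriction implies the phase restriction**: `|argB z| ≤ (π/2)|z − 1|` for unit `z` (so *"|u(p) − 1| ≦ e_kp(e_k)"*
gives `|argB u(p)| ≤ (π/2)e_kp(e_k)`; Jordan's inequality `sin x ≥ (2/π)x` on `[0, π/2]`). [cite: BalabanImbrieJaffe1988, (5.3.1) p.280] -/
theorem abs_argB_le_norm_sub_one {z : ℂ} (hz : ‖z‖ = 1) : |argB z| ≤ π / 2 * ‖z - 1‖ := by
  set θ := argB z
  have hθ : |θ| ≤ π := abs_argB_le_pi z
  have hz' : z = Complex.exp (I * (θ : ℂ)) := by rw [mul_comm]; exact (exp_argB_mul_I_of_norm hz).symm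
  have h1 : ‖z - 1‖ = 2 * |Real.sin (θ / 2)| := by
    rw [hz', Complex.norm_exp_I_mul_ofReal_sub_one, Real.norm_eq_abs, abs_mul, abs_two]
  -- Jordan's inequality on `|θ|/2 ∈ [0, π/2]`
  have hx : |θ| / 2 ≤ π / 2 := by linarith
  have h2 : 2 / π * (|θ| / 2) ≤ Real.sin (|θ| / 2) := Real.mul_le_sin (by positivity) hx
  have h3 : Real.sin (|θ| / 2) = |Real.sin (θ / 2)| := by
    rcases le_or_gt 0 θ with h | h
    · rw [abs_of_nonneg h, abs_of_nonneg (Real.sin_nonneg_of_nonneg_of_le_pi (by linarith) (by linarith [(abs_le.1 hθ).2]))]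
    · rw [abs_of_neg h, neg_div, Real.sin_neg, abs_of_nonpos]
      exact Real.sin_nonpos_of_nonpos_of_neg_pi_le (by linarith) (by linarith [(abs_le.1 hθ).1])
  rw [h1]
  have hπ := Real.pi_pos
  have h4 : 2 / π * (|θ| / 2) = |θ| / π := by ring
  rw [h4, h3] at h2
  calc |θ| = π * (|θ| / π) := by field_simp
    _ ≤ π * |Real.sin (θ / 2)| := mul_le_mul_of_nonneg_left h2 hπ.le
    _ = π / 2 * (2 * |Real.sin (θ / 2)|) := by ring

/-- kernel: a product of unit complex numbers with phases `≤ δ` is a unit complex number with phase `≤ (#factors)·δ`, as long as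
`(#factors)·δ < π`. [cite: BalabanImbrieJaffe1985, (2.11) p.303] -/
theorem abs_argB_prod_le {ι : Type*} (s : Finset ι) (f : ι → ℂ) {δ : ℝ} (hδ : 0 ≤ δ)
    (h1 : ∀ i ∈ s, ‖f i‖ = 1) (h2 : ∀ i ∈ s, |argB (f i)| ≤ δ) (hπ : s.card * δ < π) :
    ‖∏ i ∈ s, f i‖ = 1 ∧ |argB (∏ i ∈ s, f i)| ≤ s.card * δ := by
  classical
  induction s using Finset.induction_on with
  | empty => simp [argB_one_eq_zero]
  | insert a s ha ih =>
    have hcard : ((insert a s).card : ℝ) = s.card + 1 := by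
      rw [card_insert_of_notMem ha]; push_cast; ring
    rw [hcard] at hπ ⊢
    have hsδ : (s.card : ℝ) * δ ≤ (s.card + 1) * δ := by nlinarith
    obtain ⟨ihn, iha⟩ := ih (fun i hi => h1 i (mem_insert_of_mem hi)) (fun i hi => h2 i (mem_insert_of_mem hi))
      (lt_of_le_of_lt hsδ hπ)
    have ha1 : ‖f a‖ = 1 := h1 a (mem_insert_self a s)
    rw [prod_insert ha]
    refine ⟨by rw [norm_mul, ha1, ihn, one_mul], ?_⟩
    calc |argB (f a * ∏ i ∈ s, f i)| ≤ δ + s.card * δ :=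
          abs_argB_mul_le ha1 ihn (h2 a (mem_insert_self a s)) iha (by linarith)
      _ = (s.card + 1) * δ := by ring

/-! ## §1  Block coordinates: comb-tree bonds, lowering an offset, the runs of (2.10) -/

/-- kernel: a bond `⟨x, x + e_μ⟩`, `x = yL + r ∈ B(y)`, is a bond of the comb tree of (3.11) = [BalabanImbrieJaffe1985] (3.4) iff the
offsets of `x` below `μ` vanish and the bond does not leave the block. [cite: BalabanImbrieJaffe1985, (3.4) p.306] -/
theorem isAxialBond_blockSite_iff (hj : j + 1 ≤ P.m + P.K) (y : Balaban1983to89.Site P (j+1)) (r : Fin P.d → Fin P.L) (μ : Fin P.d) :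
    IsAxialBond (⟨Balaban1983to89.Site.blockSite y r, μ⟩ : PBond P j) ↔
      (∀ κ : Fin P.d, κ < μ → (r κ : ℕ) = 0) ∧ (r μ : ℕ) + 1 < P.L := by
  simp only [IsAxialBond, inBlock_blockSite hj]

/-- kernel: `δ_{Ax}(u)`: a comb-tree bond variable is `1`. [cite: BalabanImbrieJaffe1988, (3.11) p.266] -/
theorem apply_eq_one_of_isAxialBond {U : GaugeField P j U1} (hU : DeltaAx U) {b : PBond P j} (hb : IsAxialBond b) : U b = 1 :=
  hU b (mem_axialBonds.2 hb)

/-- kernel: the offsets of `yL + r` are `r`. [cite: BalabanImbrieJaffe1985, (2.4) p.302] -/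
theorem offs_blockSite (hj : j + 1 ≤ P.m + P.K) (y : Balaban1983to89.Site P (j+1)) (r : Fin P.d → Fin P.L) :
    offs (Balaban1983to89.Site.blockSite y r) = r := by
  funext κ
  exact Fin.ext (by rw [coe_offs, inBlock_blockSite hj])

/-- kernel: lowering a non-zero offset — `r = r⁻ + e_κ` with `r⁻_κ + 1 = r_κ`, the other offsets unchanged. [folklore] -/
private theorem exists_pred (r : Fin P.d → Fin P.L) {κ : Fin P.d} (hκ : (r κ : ℕ) ≠ 0) :
    ∃ (r' : Fin P.d → Fin P.L) (h : (r' κ : ℕ) + 1 < P.L), r = Function.update r' κ ⟨r' κ + 1, h⟩ ∧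
      (r' κ : ℕ) + 1 = r κ ∧ ∀ ν, ν ≠ κ → r' ν = r ν := by
  have hlt := (r κ).isLt
  refine ⟨Function.update r κ ⟨(r κ : ℕ) - 1, by omega⟩, ?_, ?_, ?_, ?_⟩
  · rw [Function.update_self]
    simp only
    omega
  · funext ν
    by_cases hν : ν = κ
    · subst hν
      rw [Function.update_self]
      apply Fin.ext
      simp only [Function.update_self]
      omega
    · rw [Function.update_of_ne hν, Function.update_of_ne hν]
  · simp only [Function.update_self]
    omega
  · intro ν hν
    rw [Function.update_of_ne hν]

/-- kernel: the lowest non-zero offset. [folklore] -/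
private theorem exists_min_ne_zero (r : Fin P.d → Fin P.L) {κ₁ : Fin P.d} (h : (r κ₁ : ℕ) ≠ 0) :
    ∃ κ₀, (r κ₀ : ℕ) ≠ 0 ∧ κ₀ ≤ κ₁ ∧ ∀ κ, κ < κ₀ → (r κ : ℕ) = 0 := by
  classical
  set S := univ.filter fun κ : Fin P.d => (r κ : ℕ) ≠ 0 with hS_def
  have hκ₁S : κ₁ ∈ S := by simp [hS_def, h]
  have hS : S.Nonempty := ⟨κ₁, hκ₁S⟩
  refine ⟨S.min' hS, ?_, min'_le S κ₁ hκ₁S, ?_⟩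
  · have hm := min'_mem S hS
    simp only [hS_def, mem_filter, mem_univ, true_and] at hm
    exact hm
  · intro κ hκ
    by_contra hne
    exact absurd hκ (not_lt.2 (min'_le S κ (by simp [hS_def, hne])))

/-- kernel: sums of offsets under lowering. [folklore] -/
private theorem sum_offs_succ {s : Finset (Fin P.d)} {κ : Fin P.d} (hκs : κ ∈ s) {r r' : Fin P.d → Fin P.L}
    (h1 : (r' κ : ℕ) + 1 = r κ) (h2 : ∀ ν, ν ≠ κ → r' ν = r ν) :
    ∑ ν ∈ s, (r ν : ℕ) = ∑ ν ∈ s, (r' ν : ℕ) + 1 := by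
  have e : ∑ ν ∈ s.erase κ, (r ν : ℕ) = ∑ ν ∈ s.erase κ, (r' ν : ℕ) :=
    sum_congr rfl fun ν hν => by rw [h2 ν (ne_of_mem_erase hν)]
  rw [← add_sum_erase s (fun ν => (r ν : ℕ)) hκs, ← add_sum_erase s (fun ν => (r' ν : ℕ)) hκs, e]
  omega

/-- kernel: `Σ_{κ∈s} r_κ ≤ (d−1)(L−1)` for a set `s` of at most `d − 1` directions. [folklore] -/
private theorem sum_offs_le (r : Fin P.d → Fin P.L) {μ : Fin P.d} {s : Finset (Fin P.d)} (hs : s ⊆ univ.erase μ) :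
    ∑ κ ∈ s, (r κ : ℕ) ≤ N₁ := by
  calc ∑ κ ∈ s, (r κ : ℕ) ≤ ∑ _κ ∈ s, (P.L - 1) := sum_le_sum fun κ _ => by have := (r κ).isLt; omega
    _ = s.card * (P.L - 1) := by rw [sum_const, smul_eq_mul]
    _ ≤ (univ.erase μ).card * (P.L - 1) := Nat.mul_le_mul_right _ (card_le_card hs)
    _ = N₁ := by rw [card_erase_of_mem (mem_univ μ), card_univ, Fintype.card_fin]

/-- kernel: the sites `yL + te_μ`, `t < L`, of the `L`-lattice bond `Γ_{y,y+e_μ}` read as a run of unit bonds from the corner `yL`, in block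
coordinates. [cite: BalabanImbrieJaffe1985, (2.10) p.303] -/
theorem runSite_corner (y : Balaban1983to89.Site P (j+1)) (μ : Fin P.d) (t : ℕ) (ht : t < P.L) :
    runSite (corner y) μ t = Balaban1983to89.Site.blockSite y (Function.update (fun _ => (⟨0, P.L_pos⟩ : Fin P.L)) μ ⟨t, ht⟩) := by
  funext κ
  by_cases hκ : κ = μ
  · subst hκ
    simp only [runSite, Function.update_self, corner, Balaban1983to89.Site.blockSite]
    push_cast
    ring
  · simp only [runSite, Function.update_of_ne hκ, corner, Balaban1983to89.Site.blockSite]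

/-- kernel: the first part of the run from `x = yL + r` in direction `μ` (while `r_μ + t < L`), in block coordinates.
[cite: BalabanImbrieJaffe1985, (2.10) p.303] -/
theorem runSite_blockSite_lo (hj : j + 1 ≤ P.m + P.K) (y : Balaban1983to89.Site P (j+1)) (r : Fin P.d → Fin P.L) (μ : Fin P.d)
    {t : ℕ} (ht : (r μ : ℕ) + t < P.L) :
    runSite (Balaban1983to89.Site.blockSite y r) μ t = Balaban1983to89.Site.blockSite y (Function.update r μ ⟨r μ + t, ht⟩) := by
  have ht' : inBlock (Balaban1983to89.Site.blockSite y r) μ + t < P.L := by rwa [inBlock_blockSite hj]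
  rw [runSite_eq_blockSite_lo hj _ μ ht', Balaban1983to89.Site.blockOf_blockSite hj]
  simp only [offs_blockSite hj, inBlock_blockSite hj]

/-- kernel: the second part of the run from `x = yL + r` (`L ≤ r_μ + t`, `t ≤ L`) lies in `B(y + e_μ)`, in block coordinates.
[cite: BalabanImbrieJaffe1985, (2.10) p.303] -/
theorem runSite_blockSite_hi (hj : j + 1 ≤ P.m + P.K) (y : Balaban1983to89.Site P (j+1)) (r : Fin P.d → Fin P.L) (μ : Fin P.d)
    {t : ℕ} (ht1 : P.L ≤ (r μ : ℕ) + t) (ht2 : t ≤ P.L) :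
    runSite (Balaban1983to89.Site.blockSite y r) μ t =
      Balaban1983to89.Site.blockSite (y.shift μ) (Function.update r μ ⟨r μ + t - P.L, by have := (r μ).isLt; omega⟩) := by
  have ht1' : P.L ≤ inBlock (Balaban1983to89.Site.blockSite y r) μ + t := by rwa [inBlock_blockSite hj]
  rw [runSite_eq_blockSite_hi hj _ μ ht1' ht2, Balaban1983to89.Site.blockOf_blockSite hj]
  simp only [offs_blockSite hj, inBlock_blockSite hj]

/-! ## §2  One transverse step across a plaquette -/

/-- kernel: the plaquette variable read in `ℂ` is the product of its four bond variables. [cite: BalabanImbrieJaffe1985, (2.5) p.302] -/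
theorem toC_plaqHol (U : GaugeField P j U1) (p : Balaban1983to89.Plaq P j) :
    toC (plaqHol U p) = toC (U ⟨p.src, p.μ⟩) * toC (U ⟨p.src.shift p.μ, p.ν⟩) * (toC (U ⟨p.src.shift p.ν, p.μ⟩))⁻¹ *
      (toC (U ⟨p.src, p.ν⟩))⁻¹ := by
  simp only [plaqHol, toC_mul, toC_inv']

/-- **One transverse step.**  For `κ ≠ μ` the bond variable `u⟨z + e_κ, μ⟩` is `u⟨z, μ⟩` times the plaquette variable of the plaquette
`⟨z; κ, μ⟩` (or the inverse of that of `⟨z; μ, κ⟩`) times `u⟨z + e_μ, κ⟩u⟨z, κ⟩^{−1}`; the plaquette factor `w` has `|argB w| ≤ ε` under the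
restriction at `z`. [cite: BalabanImbrieJaffe1988, (5.3.1) p.280] -/
theorem transverse_step {U : GaugeField P j U1} {ε : ℝ} {z : Balaban1983to89.Site P j}
    (hε : ∀ p : Balaban1983to89.Plaq P j, p.src = z → |argB (toC (plaqHol U p))| ≤ ε) {κ μ : Fin P.d} (hκμ : κ ≠ μ) :
    ∃ w : ℂ, ‖w‖ = 1 ∧ |argB w| ≤ ε ∧
      toC (U ⟨z.shift κ, μ⟩) = w * (toC (U ⟨z.shift μ, κ⟩) * (toC (U ⟨z, κ⟩))⁻¹) * toC (U ⟨z, μ⟩) := by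
  have h1 := toC_ne_zero (U ⟨z, κ⟩)
  have h2 := toC_ne_zero (U ⟨z, μ⟩)
  have h3 := toC_ne_zero (U ⟨z.shift μ, κ⟩)
  have h4 := toC_ne_zero (U ⟨z.shift κ, μ⟩)
  rcases lt_or_gt_of_ne hκμ with h | h
  · refine ⟨toC (plaqHol U ⟨z, κ, μ, h⟩), norm_toC _, hε _ rfl, ?_⟩
    rw [toC_plaqHol]
    field_simp
  · refine ⟨(toC (plaqHol U ⟨z, μ, κ, h⟩))⁻¹, by rw [norm_inv, norm_toC, inv_one],
      by rw [abs_argB_inv (norm_toC _)]; exact hε _ rfl, ?_⟩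
    rw [toC_plaqHol]
    field_simp

/-! ## §3  Interior bonds: `|argB u_b| ≤ (Σ_{κ<μ} r_κ)·ε ≤ N₁ε` -/

/-- kernel: the induction on `Σ_{κ<μ} r_κ` behind `interior_bound`. [cite: BalabanImbrieJaffe1988, (5.3.1) p.280] -/
private theorem interior_aux (hj : j + 1 ≤ P.m + P.K) {U : GaugeField P j U1} (hU : DeltaAx U)
    {y : Balaban1983to89.Site P (j+1)} {ε : ℝ} (hε₀ : 0 ≤ ε)
    (hε : ∀ p : Balaban1983to89.Plaq P j, blockOf p.src = y → |argB (toC (plaqHol U p))| ≤ ε) (μ : Fin P.d) (n : ℕ) :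
    ∀ r : Fin P.d → Fin P.L, ∑ κ ∈ univ.filter (· < μ), (r κ : ℕ) = n → (r μ : ℕ) + 1 < P.L → (n : ℝ) * ε < π →
      |argB (toC (U ⟨Balaban1983to89.Site.blockSite y r, μ⟩))| ≤ n * ε := by
  induction n with
  | zero =>
    intro r hsum hμ _
    have h0 : ∀ κ : Fin P.d, κ < μ → (r κ : ℕ) = 0 := fun κ hκ =>
      (sum_eq_zero_iff_of_nonneg fun _ _ => Nat.zero_le _).1 hsum κ (mem_filter.2 ⟨mem_univ _, hκ⟩)
    rw [apply_eq_one_of_isAxialBond hU ((isAxialBond_blockSite_iff hj y r μ).2 ⟨h0, hμ⟩), toC_one, argB_one_eq_zero]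
    simp
  | succ n ih =>
    intro r hsum hμ hπ
    obtain ⟨κ₁, hκ₁, hr₁⟩ : ∃ κ₁ ∈ univ.filter (· < μ), (r κ₁ : ℕ) ≠ 0 :=
      exists_ne_zero_of_sum_ne_zero (by rw [hsum]; exact Nat.succ_ne_zero n)
    have hκ₁μ : κ₁ < μ := (mem_filter.1 hκ₁).2
    obtain ⟨κ₀, hr₀, hκ₀₁, hlow⟩ := exists_min_ne_zero r hr₁
    have hκ₀μ : κ₀ < μ := lt_of_le_of_lt hκ₀₁ hκ₁μ
    obtain ⟨r', h', rfl, h1, h2⟩ := exists_pred r hr₀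
    have hμ' : (r' μ : ℕ) + 1 < P.L := by rw [h2 μ (ne_of_gt hκ₀μ)]; exact hμ
    have hsum' : ∑ κ ∈ univ.filter (· < μ), (r' κ : ℕ) = n := by
      have := sum_offs_succ (mem_filter.2 ⟨mem_univ κ₀, hκ₀μ⟩ : κ₀ ∈ univ.filter (· < μ)) h1 h2
      omega
    have hπ' : (n : ℝ) * ε < π := by
      have : (n : ℝ) * ε ≤ (n + 1 : ℕ) * ε := by push_cast; nlinarith
      exact lt_of_le_of_lt this hπ
    have hih := ih r' hsum' hμ' hπ'
    -- the two `κ₀`-bonds of the plaquette `⟨yL + r⁻; κ₀, μ⟩` are comb-tree bonds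
    have hz1 : U ⟨Balaban1983to89.Site.blockSite y r', κ₀⟩ = 1 :=
      apply_eq_one_of_isAxialBond hU ((isAxialBond_blockSite_iff hj y r' κ₀).2
        ⟨fun κ hκ => by rw [h2 κ (ne_of_lt hκ)]; exact hlow κ hκ, h'⟩)
    have hz2 : U ⟨(Balaban1983to89.Site.blockSite y r').shift μ, κ₀⟩ = 1 := by
      rw [shift_blockSite_of_lt y r' μ hμ']
      refine apply_eq_one_of_isAxialBond hU ((isAxialBond_blockSite_iff hj y _ κ₀).2 ⟨fun κ hκ => ?_, ?_⟩)
      · rw [Function.update_of_ne (ne_of_lt (lt_trans hκ hκ₀μ)), h2 κ (ne_of_lt hκ)]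
        exact hlow κ hκ
      · rw [Function.update_of_ne (ne_of_lt hκ₀μ)]
        exact h'
    have hεz : ∀ p : Balaban1983to89.Plaq P j, p.src = Balaban1983to89.Site.blockSite y r' → |argB (toC (plaqHol U p))| ≤ ε :=
      fun p hp => hε p (by rw [hp]; exact Balaban1983to89.Site.blockOf_blockSite hj y r')
    obtain ⟨w, hw1, hw2, hstep⟩ := transverse_step hεz (ne_of_lt hκ₀μ)
    rw [hz1, hz2, toC_one, inv_one, mul_one, mul_one] at hstep
    rw [← shift_blockSite_of_lt y r' κ₀ h', hstep]
    calc |argB (w * toC (U ⟨Balaban1983to89.Site.blockSite y r', μ⟩))| ≤ ε + n * ε :=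
          abs_argB_mul_le hw1 (norm_toC _) hw2 hih (by push_cast at hπ; linarith)
      _ = (n + 1 : ℕ) * ε := by push_cast; ring

/-- **INTERIOR BONDS, sharp form.**  In the axial gauge, if `|argB u(∂p)| ≤ ε` on the plaquettes of `B(y)`, then the variable of the interior
bond `⟨x, x + e_μ⟩`, `x = yL + r`, `r_μ + 1 < L`, has `|argB u_b| ≤ (Σ_{κ<μ} r_κ)·ε` — the number of plaquettes separating `b` from the comb
tree — provided `(Σ_{κ<μ} r_κ)·ε < π`. [cite: BalabanImbrieJaffe1988, (5.3.1) p.280] -/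
theorem interior_bound_sharp (hj : j + 1 ≤ P.m + P.K) {U : GaugeField P j U1} (hU : DeltaAx U)
    {y : Balaban1983to89.Site P (j+1)} {ε : ℝ} (hε₀ : 0 ≤ ε)
    (hε : ∀ p : Balaban1983to89.Plaq P j, blockOf p.src = y → |argB (toC (plaqHol U p))| ≤ ε)
    (r : Fin P.d → Fin P.L) {μ : Fin P.d} (hμ : (r μ : ℕ) + 1 < P.L)
    (hπ : ((∑ κ ∈ univ.filter (· < μ), (r κ : ℕ) : ℕ) : ℝ) * ε < π) :
    |argB (toC (U ⟨Balaban1983to89.Site.blockSite y r, μ⟩))| ≤ ((∑ κ ∈ univ.filter (· < μ), (r κ : ℕ) : ℕ) : ℝ) * ε :=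
  interior_aux hj hU hε₀ hε μ _ r rfl hμ hπ

/-- **INTERIOR BONDS.**  In the axial gauge, if `|argB u(∂p)| ≤ ε` on the plaquettes of `B(y)` and `N₁ε < π`, `N₁ = (d−1)(L−1)`, then every
interior bond `b = ⟨x, x + e_μ⟩ ⊂ B(y)` (`x = yL + r`, `r_μ + 1 < L`) has **`|argB u_b| ≤ N₁ε`**. [cite: BalabanImbrieJaffe1988, (5.3.1) p.280] -/
theorem interior_bound (hj : j + 1 ≤ P.m + P.K) {U : GaugeField P j U1} (hU : DeltaAx U)
    {y : Balaban1983to89.Site P (j+1)} {ε : ℝ} (hε₀ : 0 ≤ ε)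
    (hε : ∀ p : Balaban1983to89.Plaq P j, blockOf p.src = y → |argB (toC (plaqHol U p))| ≤ ε) (hπ : (N₁ : ℝ) * ε < π)
    (r : Fin P.d → Fin P.L) {μ : Fin P.d} (hμ : (r μ : ℕ) + 1 < P.L) :
    |argB (toC (U ⟨Balaban1983to89.Site.blockSite y r, μ⟩))| ≤ N₁ * ε := by
  have hle : ((∑ κ ∈ univ.filter (· < μ), (r κ : ℕ) : ℕ) : ℝ) ≤ N₁ := by
    exact_mod_cast sum_offs_le r (μ := μ) (fun κ hκ => mem_erase.2 ⟨ne_of_lt (mem_filter.1 hκ).2, mem_univ _⟩)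
  have hle' : ((∑ κ ∈ univ.filter (· < μ), (r κ : ℕ) : ℕ) : ℝ) * ε ≤ N₁ * ε := mul_le_mul_of_nonneg_right hle hε₀
  exact (interior_bound_sharp hj hU hε₀ hε r hμ (lt_of_le_of_lt hle' hπ)).trans hle'

/-- **INTERIOR BONDS, bond form**: for a bond `b` that does not leave its block (`¬ IsCross b`), the restriction on the plaquettes of the
block of `b` gives `|argB u_b| ≤ N₁ε`. [cite: BalabanImbrieJaffe1988, (5.3.1) p.280] -/
theorem interior_bound_bond (hj : j + 1 ≤ P.m + P.K) {U : GaugeField P j U1} (hU : DeltaAx U) {ε : ℝ} (hε₀ : 0 ≤ ε)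
    {b : PBond P j} (hb : ¬ IsCross b)
    (hε : ∀ p : Balaban1983to89.Plaq P j, blockOf p.src = blockOf b.src → |argB (toC (plaqHol U p))| ≤ ε) (hπ : (N₁ : ℝ) * ε < π) :
    |argB (toC (U b))| ≤ N₁ * ε := by
  obtain ⟨x, μ⟩ := b
  have hlt : (offs x μ : ℕ) + 1 < P.L := by
    have h1 : inBlock x μ < P.L := Nat.mod_lt _ P.L_pos
    have h2 : inBlock x μ + 1 ≠ P.L := hb
    rw [coe_offs]; omega
  have e : (⟨x, μ⟩ : PBond P j) = ⟨Balaban1983to89.Site.blockSite (blockOf x) (offs x), μ⟩ := by rw [blockSite_offs hj]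
  rw [e]
  exact interior_bound hj hU hε₀ hε hπ (offs x) hlt

/-! ## §4  Surface bonds against the face bond on the corner line -/

/-- kernel: the induction on `Σ_{κ≠μ} r_κ` behind `surface_bound`. [cite: BalabanImbrieJaffe1988, (5.3.1) p.280] -/
private theorem surface_aux (hj : j + 1 ≤ P.m + P.K) {U : GaugeField P j U1} (hU : DeltaAx U)
    {y : Balaban1983to89.Site P (j+1)} {μ : Fin P.d} {ε : ℝ} (hε₀ : 0 ≤ ε)
    (hε : ∀ p : Balaban1983to89.Plaq P j, blockOf p.src = y ∨ blockOf p.src = y.shift μ → |argB (toC (plaqHol U p))| ≤ ε)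
    (hπ₁ : (N₁ : ℝ) * ε < π) (m : ℕ) :
    ∀ r : Fin P.d → Fin P.L, ∑ κ ∈ univ.erase μ, (r κ : ℕ) = m → (r μ : ℕ) + 1 = P.L → (m : ℝ) * (1 + 2 * N₁) * ε < π →
      |argB (toC (U ⟨Balaban1983to89.Site.blockSite y r, μ⟩) * (toC (U (runBond (corner y) μ (P.L - 1))))⁻¹)| ≤
        m * (1 + 2 * N₁) * ε := by
  induction m with
  | zero =>
    intro r hsum hμ _
    have h0 : ∀ κ : Fin P.d, κ ≠ μ → (r κ : ℕ) = 0 := fun κ hκ =>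
      (sum_eq_zero_iff_of_nonneg fun _ _ => Nat.zero_le _).1 hsum κ (mem_erase.2 ⟨hκ, mem_univ _⟩)
    have hr : r = Function.update (fun _ => (⟨0, P.L_pos⟩ : Fin P.L)) μ ⟨P.L - 1, by have := P.hL.2; omega⟩ := by
      funext κ
      by_cases hκ : κ = μ
      · subst hκ; rw [Function.update_self]; exact Fin.ext (by simp only; omega)
      · rw [Function.update_of_ne hκ]; exact Fin.ext (by simp only; exact h0 κ hκ)
    have hb : runBond (corner y) μ (P.L - 1) = ⟨Balaban1983to89.Site.blockSite y r, μ⟩ := by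
      rw [hr, ← runSite_corner y μ (P.L - 1) (by have := P.hL.2; omega)]
      rfl
    rw [hb, mul_inv_cancel₀ (toC_ne_zero _), argB_one_eq_zero]
    simp
  | succ m ih =>
    intro r hsum hμ hπ
    obtain ⟨κ₀, hκ₀, hr₀⟩ : ∃ κ₀ ∈ univ.erase μ, (r κ₀ : ℕ) ≠ 0 :=
      exists_ne_zero_of_sum_ne_zero (by rw [hsum]; exact Nat.succ_ne_zero m)
    have hκ₀μ : κ₀ ≠ μ := (mem_erase.1 hκ₀).1
    obtain ⟨r', h', rfl, h1, h2⟩ := exists_pred r hr₀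
    have hμ' : (r' μ : ℕ) + 1 = P.L := by rw [h2 μ hκ₀μ.symm]; exact hμ
    have hsum' : ∑ κ ∈ univ.erase μ, (r' κ : ℕ) = m := by
      have := sum_offs_succ hκ₀ h1 h2
      omega
    have hN : (0 : ℝ) ≤ 1 + 2 * N₁ := by positivity
    rw [Nat.cast_succ] at hπ
    have hπ' : (m : ℝ) * (1 + 2 * N₁) * ε < π := by nlinarith [mul_nonneg hN hε₀]
    have hih := ih r' hsum' hμ' hπ'
    -- the plaquette step at `z = yL + r⁻`
    have hεz : ∀ p : Balaban1983to89.Plaq P j, p.src = Balaban1983to89.Site.blockSite y r' → |argB (toC (plaqHol U p))| ≤ ε :=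
      fun p hp => hε p (Or.inl (by rw [hp]; exact Balaban1983to89.Site.blockOf_blockSite hj y r'))
    obtain ⟨w, hw1, hw2, hstep⟩ := transverse_step hεz hκ₀μ
    -- the two `κ₀`-bonds are interior bonds of `B(y)` and `B(y + e_μ)`
    have hb1 : |argB (toC (U ⟨Balaban1983to89.Site.blockSite y r', κ₀⟩))| ≤ N₁ * ε :=
      interior_bound hj hU hε₀ (fun p hp => hε p (Or.inl hp)) hπ₁ r' h'
    have hb2 : |argB (toC (U ⟨(Balaban1983to89.Site.blockSite y r').shift μ, κ₀⟩))⁻¹| ≤ N₁ * ε := by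
      rw [abs_argB_inv (norm_toC _), shift_blockSite_of_eq hj y r' μ hμ']
      refine interior_bound hj hU hε₀ (fun p hp => hε p (Or.inr hp)) hπ₁ _ ?_
      rw [Function.update_of_ne hκ₀μ]
      exact h'
    have hX : |argB (toC (U ⟨(Balaban1983to89.Site.blockSite y r').shift μ, κ₀⟩))| ≤ N₁ * ε := by
      rw [shift_blockSite_of_eq hj y r' μ hμ']
      refine interior_bound hj hU hε₀ (fun p hp => hε p (Or.inr hp)) hπ₁ _ ?_
      rw [Function.update_of_ne hκ₀μ]
      exact h'
    have hY : |argB (toC (U ⟨Balaban1983to89.Site.blockSite y r', κ₀⟩))⁻¹| ≤ N₁ * ε := by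
      rw [abs_argB_inv (norm_toC _)]
      exact interior_bound hj hU hε₀ (fun p hp => hε p (Or.inl hp)) hπ₁ r' h'
    have hKε : (1 + 2 * (N₁ : ℝ)) * ε ≤ ((m : ℝ) + 1) * (1 + 2 * N₁) * ε := by
      nlinarith [mul_nonneg hN hε₀, (Nat.cast_nonneg m : (0 : ℝ) ≤ m)]
    have hXY := abs_argB_mul_le (norm_toC _) (by rw [norm_inv, norm_toC, inv_one]) hX hY (by linarith)
    have hwXY := abs_argB_mul_le hw1 (norm_toC_mul_inv _ _) hw2 hXY (by linarith)
    have hfin := abs_argB_mul_le (by rw [norm_mul, hw1, norm_toC_mul_inv, one_mul]) (norm_toC_mul_inv _ _) hwXY hih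
      (by linarith)
    rw [← shift_blockSite_of_lt y r' κ₀ h', hstep, mul_assoc (w * _) _ _]
    calc _ ≤ ε + (N₁ * ε + N₁ * ε) + m * (1 + 2 * N₁) * ε := hfin
      _ = (m + 1 : ℕ) * (1 + 2 * N₁) * ε := by push_cast; ring

/-- **SURFACE BONDS, sharp form.**  In the axial gauge, with `|argB u(∂p)| ≤ ε` on the plaquettes of `B(y)` and `B(y + e_μ)`: the variable
of the surface bond `b = ⟨x, x + e_μ⟩`, `x = yL + r` on the face `r_μ = L − 1`, compared with the face bond `b* = ⟨yL + (L−1)e_μ, yL + Le_μ⟩`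
on the corner line (the last unit bond of `Γ_{y,y+e_μ}`), satisfies `|argB(u_bu_{b*}^{−1})| ≤ (Σ_{κ≠μ} r_κ)(1 + 2N₁)ε`, provided
`N₁ε < π` and `(Σ_{κ≠μ} r_κ)(1 + 2N₁)ε < π`. [cite: BalabanImbrieJaffe1988, (5.3.1) p.280] -/
theorem surface_bound_sharp (hj : j + 1 ≤ P.m + P.K) {U : GaugeField P j U1} (hU : DeltaAx U)
    {y : Balaban1983to89.Site P (j+1)} {μ : Fin P.d} {ε : ℝ} (hε₀ : 0 ≤ ε)
    (hε : ∀ p : Balaban1983to89.Plaq P j, blockOf p.src = y ∨ blockOf p.src = y.shift μ → |argB (toC (plaqHol U p))| ≤ ε)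
    (hπ₁ : (N₁ : ℝ) * ε < π) (r : Fin P.d → Fin P.L) (hr : (r μ : ℕ) + 1 = P.L)
    (hπ : ((∑ κ ∈ univ.erase μ, (r κ : ℕ) : ℕ) : ℝ) * (1 + 2 * N₁) * ε < π) :
    |argB (toC (U ⟨Balaban1983to89.Site.blockSite y r, μ⟩) * (toC (U (runBond (corner y) μ (P.L - 1))))⁻¹)| ≤
      ((∑ κ ∈ univ.erase μ, (r κ : ℕ) : ℕ) : ℝ) * (1 + 2 * N₁) * ε :=
  surface_aux hj hU hε₀ hε hπ₁ _ r rfl hr hπ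

/-- kernel: `N₂ = N₁(1 + 2N₁)` read in `ℝ`. [folklore] -/
private theorem cast_N₂ : (((P.d - 1) * (P.L - 1) * (1 + 2 * ((P.d - 1) * (P.L - 1))) : ℕ) : ℝ) =
    (((P.d - 1) * (P.L - 1) : ℕ) : ℝ) * (1 + 2 * (((P.d - 1) * (P.L - 1) : ℕ) : ℝ)) := by push_cast; ring

/-- **SURFACE BONDS.**  In the axial gauge, with `|argB u(∂p)| ≤ ε` on the plaquettes of the two blocks `B(y)`, `B(y + e_μ)` and `N₂ε < π`,
`N₂ = N₁(1 + 2N₁)`: every surface bond `b = ⟨x, x + e_μ⟩` from `B(y)` to `B(y + e_μ)` (`x = yL + r`, `r_μ + 1 = L`) satisfies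
**`|argB(u_b·u_{b*}^{−1})| ≤ N₂ε`**, `b*` the surface bond on the corner line. [cite: BalabanImbrieJaffe1988, (5.3.1) p.280] -/
theorem surface_bound (hj : j + 1 ≤ P.m + P.K) {U : GaugeField P j U1} (hU : DeltaAx U)
    {y : Balaban1983to89.Site P (j+1)} {μ : Fin P.d} {ε : ℝ} (hε₀ : 0 ≤ ε)
    (hε : ∀ p : Balaban1983to89.Plaq P j, blockOf p.src = y ∨ blockOf p.src = y.shift μ → |argB (toC (plaqHol U p))| ≤ ε)
    (hπ : (N₂ : ℝ) * ε < π) (r : Fin P.d → Fin P.L) (hr : (r μ : ℕ) + 1 = P.L) :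
    |argB (toC (U ⟨Balaban1983to89.Site.blockSite y r, μ⟩) * (toC (U (runBond (corner y) μ (P.L - 1))))⁻¹)| ≤ N₂ * ε := by
  rw [cast_N₂] at hπ ⊢
  have hN : (0 : ℝ) ≤ 1 + 2 * N₁ := by positivity
  have hle : ((∑ κ ∈ univ.erase μ, (r κ : ℕ) : ℕ) : ℝ) ≤ N₁ := by exact_mod_cast sum_offs_le r (μ := μ) subset_rfl
  have hle' : ((∑ κ ∈ univ.erase μ, (r κ : ℕ) : ℕ) : ℝ) * (1 + 2 * N₁) * ε ≤ N₁ * (1 + 2 * N₁) * ε := by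
    nlinarith [mul_nonneg hN hε₀]
  have hπ₁ : (N₁ : ℝ) * ε < π := by nlinarith [mul_nonneg (Nat.cast_nonneg _ : (0 : ℝ) ≤ N₁) hε₀]
  exact (surface_bound_sharp hj hU hε₀ hε hπ₁ r hr (lt_of_le_of_lt hle' hπ)).trans hle'

/-! ## §5  The average (2.10) in the axial gauge: `u(Γ_{yy′}) = u_{b*}`, the loops, `(Qu)_{yy′} = u_{b*}·e^{i·average}` -/

/-- kernel: the first `L − 1` unit bonds of `Γ_{y,y+e_μ}` (read from the corner `yL`) are comb-tree bonds. [cite: BalabanImbrieJaffe1985, (3.4) p.306] -/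
theorem isAxialBond_runBond_corner (hj : j + 1 ≤ P.m + P.K) (y : Balaban1983to89.Site P (j+1)) (μ : Fin P.d) {t : ℕ}
    (ht : t + 1 < P.L) : IsAxialBond (runBond (corner y) μ t) := by
  have htL : t < P.L := by omega
  show IsAxialBond ⟨runSite (corner y) μ t, μ⟩
  rw [runSite_corner y μ t htL, isAxialBond_blockSite_iff hj]
  refine ⟨fun κ hκ => ?_, ?_⟩
  · simp [Function.update_of_ne (ne_of_lt hκ)]
  · simp only [Function.update_self]
    exact ht

/-- **`u(Γ_{y,y+e_μ}) = u_{b*}` in the axial gauge**: of the `L` unit bonds of the `L`-lattice bond only the last one, the face bond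
`b* = ⟨yL + (L−1)e_μ, yL + Le_μ⟩` on the corner line, is not a tree bond. [cite: BalabanImbrieJaffe1985, (2.10) p.303] -/
theorem runC_corner_of_deltaAx (hj : j + 1 ≤ P.m + P.K) {U : GaugeField P j U1} (hU : DeltaAx U)
    (y : Balaban1983to89.Site P (j+1)) (μ : Fin P.d) :
    runC U (corner y) μ = toC (U (runBond (corner y) μ (P.L - 1))) := by
  have hL := P.hL.2
  have hmem : P.L - 1 ∈ range P.L := mem_range.2 (by omega)
  have h1 : ∏ t ∈ (range P.L).erase (P.L - 1), toC (U (runBond (corner y) μ t)) = 1 := prod_eq_one fun t ht => by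
    obtain ⟨hne, htL⟩ := mem_erase.1 ht
    rw [mem_range] at htL
    rw [apply_eq_one_of_isAxialBond hU (isAxialBond_runBond_corner hj y μ (by omega)), toC_one]
  rw [runC, ← mul_prod_erase (range P.L) (fun t => toC (U (runBond (corner y) μ t))) hmem, h1, mul_one]

/-- kernel: the same for the total phase, `Σ_t argB u(b_t) = argB u_{b*}`. [cite: BalabanImbrieJaffe1985, (2.11) p.303] -/
theorem runArg_corner_of_deltaAx (hj : j + 1 ≤ P.m + P.K) {U : GaugeField P j U1} (hU : DeltaAx U)
    (y : Balaban1983to89.Site P (j+1)) (μ : Fin P.d) :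
    runArg U (corner y) μ = argB (toC (U (runBond (corner y) μ (P.L - 1)))) := by
  have hL := P.hL.2
  have hmem : P.L - 1 ∈ range P.L := mem_range.2 (by omega)
  have h1 : ∑ t ∈ (range P.L).erase (P.L - 1), argB (toC (U (runBond (corner y) μ t))) = 0 := sum_eq_zero fun t ht => by
    obtain ⟨hne, htL⟩ := mem_erase.1 ht
    rw [mem_range] at htL
    rw [apply_eq_one_of_isAxialBond hU (isAxialBond_runBond_corner hj y μ (by omega)), toC_one, argB_one_eq_zero]
  rw [runArg, ← add_sum_erase (range P.L) (fun t => argB (toC (U (runBond (corner y) μ t)))) hmem, h1, add_zero]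

/-- **The loop of (2.10) in the axial gauge**: `u(Γ_{yx}∘Γ_{xx′}∘Γ_{y′x′}^{−1}∘Γ_{y′y}) = u(Γ_{xx′})·u_{b*}^{−1}` — the combs `Γ_{yx}`, `Γ_{y′x′}`
are trivial and `u(Γ_{yy′}) = u_{b*}`. [cite: BalabanImbrieJaffe1985, (2.10) p.303] -/
theorem loopC_of_deltaAx (hj : j + 1 ≤ P.m + P.K) {U : GaugeField P j U1} (hU : DeltaAx U) (c : PBond P (j+1))
    (x : Balaban1983to89.Site P j) :
    loopC U c x = runC U x c.dir * (toC (U (runBond (corner c.src) c.dir (P.L - 1))))⁻¹ := by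
  rw [loopC, holC_of_deltaAx hj hU, holC_of_deltaAx hj hU, runC_corner_of_deltaAx hj hU, inv_one, one_mul, mul_one]

/-- **`(Qu)_{yy′} = u_{b*}·exp(i·L^{−d}Σ_{x∈B(y)} argB u(loop_x))` in the axial gauge** ((2.10) read in `ℂ`).
[cite: BalabanImbrieJaffe1985, (2.10) p.303] -/
theorem toC_qU_of_deltaAx (hj : j + 1 ≤ P.m + P.K) {U : GaugeField P j U1} (hU : DeltaAx U) (c : PBond P (j+1)) :
    toC (qU U c) = toC (U (runBond (corner c.src) c.dir (P.L - 1))) * Complex.exp ((loopAvg U c : ℂ) * I) := by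
  rw [toC_qU, runC_corner_of_deltaAx hj hU]

/-- kernel: `N₃ = (L−1)N₁ + N₂` read in `ℝ`. [folklore] -/
private theorem cast_N₃ :
    (((P.L - 1) * ((P.d - 1) * (P.L - 1)) + (P.d - 1) * (P.L - 1) * (1 + 2 * ((P.d - 1) * (P.L - 1))) : ℕ) : ℝ) =
      ((P.L - 1 : ℕ) : ℝ) * (((P.d - 1) * (P.L - 1) : ℕ) : ℝ) +
        (((P.d - 1) * (P.L - 1) * (1 + 2 * ((P.d - 1) * (P.L - 1))) : ℕ) : ℝ) := by
  push_cast; ring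

/-- kernel: the unit bonds of the run `Γ_{x,x+Le_μ}`, `x = yL + r`, other than the one crossing from `B(y)` to `B(y + e_μ)` (index
`t* = L − 1 − r_μ`), are interior bonds of `B(y)` (`t < t*`) or of `B(y + e_μ)` (`t > t*`); their variables have `|argB| ≤ N₁ε`.
[cite: BalabanImbrieJaffe1988, (5.3.1) p.280] -/
private theorem run_interior_bound (hj : j + 1 ≤ P.m + P.K) {U : GaugeField P j U1} (hU : DeltaAx U)
    {y : Balaban1983to89.Site P (j+1)} {μ : Fin P.d} {ε : ℝ} (hε₀ : 0 ≤ ε)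
    (hε : ∀ p : Balaban1983to89.Plaq P j, blockOf p.src = y ∨ blockOf p.src = y.shift μ → |argB (toC (plaqHol U p))| ≤ ε)
    (hπ₁ : (N₁ : ℝ) * ε < π) (r : Fin P.d → Fin P.L) {t : ℕ} (ht : t ∈ (range P.L).erase (P.L - 1 - (r μ : ℕ))) :
    |argB (toC (U (runBond (Balaban1983to89.Site.blockSite y r) μ t)))| ≤ N₁ * ε := by
  obtain ⟨hne, htL⟩ := mem_erase.1 ht
  rw [mem_range] at htL
  have hrμ := (r μ).isLt
  show |argB (toC (U ⟨runSite (Balaban1983to89.Site.blockSite y r) μ t, μ⟩))| ≤ _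
  rcases lt_or_gt_of_ne hne with hlt | hgt
  · rw [runSite_blockSite_lo hj y r μ (t := t) (by omega)]
    refine interior_bound hj hU hε₀ (fun p hp => hε p (Or.inl hp)) hπ₁ _ ?_
    simp only [Function.update_self]
    omega
  · rw [runSite_blockSite_hi hj y r μ (t := t) (by omega) htL.le]
    refine interior_bound hj hU hε₀ (fun p hp => hε p (Or.inr hp)) hπ₁ _ ?_
    simp only [Function.update_self]
    omega

/-- **THE LOOPS OF (2.10).**  In the axial gauge, with `|argB u(∂p)| ≤ ε` on the plaquettes of `B(y)`, `B(y + e_μ)` and `N₃ε < π`,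
`N₃ = (L−1)N₁ + N₂`: for every `x ∈ B(y)` the loop variable of (2.10) for the `L`-lattice bond `⟨y, y + e_μ⟩` satisfies
**`|argB u(loop_x)| ≤ N₃ε`** — the loop is (`L − 1` interior bonds) × (surface bond / `u_{b*}`). [cite: BalabanImbrieJaffe1988, (5.3.1) p.280] -/
theorem abs_argB_loopC_le (hj : j + 1 ≤ P.m + P.K) {U : GaugeField P j U1} (hU : DeltaAx U)
    {y : Balaban1983to89.Site P (j+1)} {μ : Fin P.d} {ε : ℝ} (hε₀ : 0 ≤ ε)
    (hε : ∀ p : Balaban1983to89.Plaq P j, blockOf p.src = y ∨ blockOf p.src = y.shift μ → |argB (toC (plaqHol U p))| ≤ ε)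
    (hπ : (N₃ : ℝ) * ε < π) (r : Fin P.d → Fin P.L) :
    |argB (loopC U ⟨y, μ⟩ (Balaban1983to89.Site.blockSite y r))| ≤ N₃ * ε := by
  have hL := P.hL.2
  have hrμ := (r μ).isLt
  have hN₁ : (0 : ℝ) ≤ N₁ := Nat.cast_nonneg _
  have hN₂ : (0 : ℝ) ≤ N₂ := Nat.cast_nonneg _
  have hL1 : (0 : ℝ) ≤ ((P.L - 1 : ℕ) : ℝ) := Nat.cast_nonneg _
  rw [cast_N₃] at hπ ⊢
  have hπ₂ : (N₂ : ℝ) * ε < π := by nlinarith [mul_nonneg (mul_nonneg hL1 hN₁) hε₀]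
  have hπ₁ : (N₁ : ℝ) * ε < π := by
    have h := hπ₂
    rw [cast_N₂] at h
    nlinarith [mul_nonneg (mul_nonneg hN₁ hN₁) hε₀]
  -- the crossing index `t* = L − 1 − r_μ` and the crossing bond = the surface bond on the line of `x`
  have hmem : P.L - 1 - (r μ : ℕ) ∈ range P.L := mem_range.2 (by omega)
  have hcross : runBond (Balaban1983to89.Site.blockSite y r) μ (P.L - 1 - (r μ : ℕ)) =
      ⟨Balaban1983to89.Site.blockSite y (Function.update r μ ⟨P.L - 1, by omega⟩), μ⟩ := by
    show (⟨runSite (Balaban1983to89.Site.blockSite y r) μ (P.L - 1 - (r μ : ℕ)), μ⟩ : PBond P j) = _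
    rw [runSite_blockSite_lo hj y r μ (t := P.L - 1 - (r μ : ℕ)) (by omega)]
    have hfin : (⟨(r μ : ℕ) + (P.L - 1 - (r μ : ℕ)), by omega⟩ : Fin P.L) = ⟨P.L - 1, by omega⟩ :=
      Fin.ext (show (r μ : ℕ) + (P.L - 1 - (r μ : ℕ)) = P.L - 1 by omega)
    rw [hfin]
  -- the surface factor `u_{b_x}u_{b*}^{−1}`
  have hsurf := surface_bound hj hU hε₀ hε hπ₂ (Function.update r μ ⟨P.L - 1, by omega⟩)
    (by simp only [Function.update_self]; omega)
  rw [← hcross] at hsurf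
  -- the `L − 1` interior factors
  have hcard : (((range P.L).erase (P.L - 1 - (r μ : ℕ))).card : ℝ) = ((P.L - 1 : ℕ) : ℝ) := by
    rw [card_erase_of_mem hmem, card_range]
  have hprod := abs_argB_prod_le ((range P.L).erase (P.L - 1 - (r μ : ℕ)))
    (fun t => toC (U (runBond (Balaban1983to89.Site.blockSite y r) μ t))) (mul_nonneg hN₁ hε₀) (fun t _ => norm_toC _)
    (fun t ht => run_interior_bound hj hU hε₀ hε hπ₁ r ht) (by rw [hcard]; nlinarith [mul_nonneg hN₂ hε₀])
  rw [hcard] at hprod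
  obtain ⟨hn, ha⟩ := hprod
  rw [loopC_of_deltaAx hj hU]
  dsimp only
  rw [runC, ← mul_prod_erase (range P.L) (fun t => toC (U (runBond (Balaban1983to89.Site.blockSite y r) μ t))) hmem,
    mul_right_comm, mul_comm]
  calc _ ≤ ((P.L - 1 : ℕ) : ℝ) * (N₁ * ε) + N₂ * ε := abs_argB_mul_le hn (norm_toC_mul_inv _ _) ha hsurf (by nlinarith)
    _ = (((P.L - 1 : ℕ) : ℝ) * N₁ + N₂) * ε := by ring

/-- **The exponent of (2.10) is small**: `|L^{−d}Σ_{x∈B(y)} argB u(loop_x)| ≤ N₃ε` under the same hypotheses.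
[cite: BalabanImbrieJaffe1988, (5.3.1) p.280] -/
theorem abs_loopAvg_le (hj : j + 1 ≤ P.m + P.K) {U : GaugeField P j U1} (hU : DeltaAx U)
    {y : Balaban1983to89.Site P (j+1)} {μ : Fin P.d} {ε : ℝ} (hε₀ : 0 ≤ ε)
    (hε : ∀ p : Balaban1983to89.Plaq P j, blockOf p.src = y ∨ blockOf p.src = y.shift μ → |argB (toC (plaqHol U p))| ≤ ε)
    (hπ : (N₃ : ℝ) * ε < π) : |loopAvg U ⟨y, μ⟩| ≤ N₃ * ε := by
  have hL : (0 : ℝ) < P.L := by exact_mod_cast P.L_pos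
  have hLd : (0 : ℝ) < (P.L : ℝ) ^ P.d := by positivity
  show |((P.L : ℝ) ^ P.d)⁻¹ * ∑ x ∈ block y, argB (loopC U ⟨y, μ⟩ x)| ≤ _
  rw [abs_mul, abs_inv, abs_of_pos hLd]
  have hsum : |∑ x ∈ block y, argB (loopC U ⟨y, μ⟩ x)| ≤ (block y).card * (N₃ * ε) := by
    refine (abs_sum_le_sum_abs _ _).trans ((sum_le_sum fun x hx => ?_).trans_eq (by rw [sum_const, nsmul_eq_mul]))
    have ex : x = Balaban1983to89.Site.blockSite y (offs x) := by rw [← mem_block_iff.1 hx, blockSite_offs hj]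
    rw [ex]
    exact abs_argB_loopC_le hj hU hε₀ hε hπ (offs x)
  calc ((P.L : ℝ) ^ P.d)⁻¹ * |∑ x ∈ block y, argB (loopC U ⟨y, μ⟩ x)| ≤ ((P.L : ℝ) ^ P.d)⁻¹ * ((block y).card * (N₃ * ε)) :=
        mul_le_mul_of_nonneg_left hsum (inv_nonneg.2 hLd.le)
    _ = N₃ * ε := by
        rw [Balaban1983to89.Site.card_block hj]
        push_cast
        field_simp

/-! ## §6  The translated field `u′ = u(Q^{s*}Qu)^{−1}`: `|argB u′_b| ≤ c(d, L)·ε`, i.e. `u′_b = e^{ie_kA′_b}`, `|A′_b| ≤ cp(e_k)` -/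

/-- **`u′` on a surface bond, factorised**: `u′_b = (u_bu_{b*}^{−1})·exp(−i·L^{−d}Σ_x argB u(loop_x))` (`b*` the face bond on the corner
line of the coarse bond `b′ ∋ b`). [cite: BalabanImbrieJaffe1988, (5.3.1) p.280] -/
theorem toC_uPrime_of_isCross (hj : j + 1 ≤ P.m + P.K) {U : GaugeField P j U1} (hU : DeltaAx U) {b : PBond P j} (hb : IsCross b) :
    toC (uPrime U b) = toC (U b) * (toC (U (runBond (corner (coarse b).src) (coarse b).dir (P.L - 1))))⁻¹ *
      (Complex.exp ((loopAvg U (coarse b) : ℂ) * I))⁻¹ := by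
  rw [uPrime, surfMul_of_isCross _ _ hb, toC_mul, toC_inv', toC_qU_of_deltaAx hj hU, mul_inv, mul_assoc]

/-- kernel: `u′_b = u_b` off the surface bonds ((3.9) first case). [cite: BalabanImbrieJaffe1985, (3.9) p.307] -/
theorem uPrime_of_not_isCross (U : GaugeField P j U1) {b : PBond P j} (hb : ¬ IsCross b) : uPrime U b = U b :=
  surfMul_of_not_isCross _ _ hb

/-- **THE p. 280 SENTENCE ON A SURFACE BOND.**  In the axial gauge, if `|argB u(∂p)| ≤ ε` on the plaquettes of the two blocks met by
the surface bond `b` and `(N₂ + N₃)ε < π`, then `|argB u′_b| ≤ (N₂ + N₃)ε`. [cite: BalabanImbrieJaffe1988, (5.3.1) p.280] -/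
theorem abs_argB_uPrime_of_isCross (hj : j + 1 ≤ P.m + P.K) {U : GaugeField P j U1} (hU : DeltaAx U) {ε : ℝ} (hε₀ : 0 ≤ ε)
    {b : PBond P j} (hb : IsCross b)
    (hε : ∀ p : Balaban1983to89.Plaq P j, blockOf p.src = blockOf b.src ∨ blockOf p.src = (blockOf b.src).shift b.dir →
      |argB (toC (plaqHol U p))| ≤ ε)
    (hπ : ((N₂ + N₃ : ℕ) : ℝ) * ε < π) : |argB (toC (uPrime U b))| ≤ (N₂ + N₃ : ℕ) * ε := by
  obtain ⟨x, μ⟩ := b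
  have hN₂ : (0 : ℝ) ≤ N₂ := Nat.cast_nonneg _
  have hN₃ : (0 : ℝ) ≤ N₃ := Nat.cast_nonneg _
  rw [Nat.cast_add] at hπ ⊢
  have hπ₂ : (N₂ : ℝ) * ε < π := by nlinarith [mul_nonneg hN₃ hε₀]
  have hπ₃ : (N₃ : ℝ) * ε < π := by nlinarith [mul_nonneg hN₂ hε₀]
  have hxμ : (offs x μ : ℕ) + 1 = P.L := by rw [coe_offs]; exact hb
  have hD := surface_bound hj hU hε₀ hε hπ₂ (offs x) hxμ
  rw [blockSite_offs hj] at hD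
  have hℓ := abs_loopAvg_le hj hU hε₀ hε hπ₃
  have hE : |argB (Complex.exp ((loopAvg U ⟨blockOf x, μ⟩ : ℂ) * I))⁻¹| ≤ N₃ * ε := by
    rw [abs_argB_inv (norm_exp_ofReal_mul_I _), argB_exp_of_abs_lt (lt_of_le_of_lt hℓ hπ₃)]
    exact hℓ
  rw [toC_uPrime_of_isCross hj hU hb]
  dsimp only [coarse]
  calc _ ≤ N₂ * ε + N₃ * ε :=
        abs_argB_mul_le (norm_toC_mul_inv _ _) (by rw [norm_inv, norm_exp_ofReal_mul_I, inv_one]) hD hE (by linarith)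
    _ = (N₂ + N₃) * ε := by ring

/-- kernel: `N₁ ≤ N₂ + N₃`. [folklore] -/
private theorem N₁_le : N₁ ≤ N₂ + N₃ :=
  le_trans (Nat.le_mul_of_pos_right _ (by omega)) (Nat.le_add_right _ _)

/-- **THE p. 280 SENTENCE, every bond, sharp constant.**  *"Using the restrictions |u(p) − 1| ≦ e_kp(e_k) … and the axial gauge
conditions, we obtain that u′_b = e^{ie_kA′_b} with |A′_b| ≦ cp(e_k)"*: in the axial gauge `δ_{Ax}(u)`, if `|argB u(∂p)| ≤ ε` on the
plaquettes of the block of `b` and of the next block in the direction of `b`, and `c·ε < π`, then **`|argB u′_b| ≤ c·ε`** with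
`c = N₂ + N₃ = N₁(4N₁ + L + 1)`, `N₁ = (d−1)(L−1)` (`u′ = BIJ85BlockAveragesTorus.uPrime u`; with `ε = e_kp(e_k)` this is `|A′_b| ≤ cp(e_k)`
for `A′_b = argB(u′_b)/e_k`, see `smallAPrime_of_plaquettes`). [cite: BalabanImbrieJaffe1988, (5.3.1) p.280] -/
theorem abs_argB_uPrime_le (hj : j + 1 ≤ P.m + P.K) {U : GaugeField P j U1} (hU : DeltaAx U) {ε : ℝ} (hε₀ : 0 ≤ ε) (b : PBond P j)
    (hε : ∀ p : Balaban1983to89.Plaq P j, blockOf p.src = blockOf b.src ∨ blockOf p.src = (blockOf b.src).shift b.dir →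
      |argB (toC (plaqHol U p))| ≤ ε)
    (hπ : ((N₂ + N₃ : ℕ) : ℝ) * ε < π) : |argB (toC (uPrime U b))| ≤ (N₂ + N₃ : ℕ) * ε := by
  by_cases hb : IsCross b
  · exact abs_argB_uPrime_of_isCross hj hU hε₀ hb hε hπ
  · rw [uPrime_of_not_isCross U hb]
    have hle : (N₁ : ℝ) * ε ≤ (N₂ + N₃ : ℕ) * ε := mul_le_mul_of_nonneg_right (by exact_mod_cast N₁_le) hε₀
    exact (interior_bound_bond hj hU hε₀ hb (fun p hp => hε p (Or.inl hp)) (lt_of_le_of_lt hle hπ)).trans hle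

/-- kernel: `c = N₂ + N₃ ≤ 6d²L²`. [folklore] -/
private theorem const_le_six : N₂ + N₃ ≤ 6 * P.d ^ 2 * P.L ^ 2 := by
  have hd := P.hd
  have hL := P.hL.2
  set a := (P.d - 1) * (P.L - 1) with ha
  have ha1 : a ≤ P.d * P.L := Nat.mul_le_mul (Nat.sub_le _ _) (Nat.sub_le _ _)
  have hdl : P.L ≤ P.d * P.L := Nat.le_mul_of_pos_left _ hd
  have e : a * (1 + 2 * a) + ((P.L - 1) * a + a * (1 + 2 * a)) = a * (4 * a + (P.L - 1) + 2) := by ring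
  rw [e]
  have h2 : 4 * a + (P.L - 1) + 2 ≤ 6 * (P.d * P.L) := by omega
  calc a * (4 * a + (P.L - 1) + 2) ≤ (P.d * P.L) * (6 * (P.d * P.L)) := Nat.mul_le_mul ha1 h2
    _ = 6 * P.d ^ 2 * P.L ^ 2 := by ring

/-- **THE p. 280 SENTENCE, every bond, `c = 6d²L²`.**  In the axial gauge, if `|argB u(∂p)| ≤ ε` on the plaquettes of the block of `b`
and of the next block in the direction of `b`, and `6d²L²ε < π`, then **`|argB u′_b| ≤ 6d²L²·ε`**. [cite: BalabanImbrieJaffe1988, (5.3.1) p.280] -/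
theorem abs_argB_uPrime_le_six (hj : j + 1 ≤ P.m + P.K) {U : GaugeField P j U1} (hU : DeltaAx U) {ε : ℝ} (hε₀ : 0 ≤ ε)
    (b : PBond P j)
    (hε : ∀ p : Balaban1983to89.Plaq P j, blockOf p.src = blockOf b.src ∨ blockOf p.src = (blockOf b.src).shift b.dir →
      |argB (toC (plaqHol U p))| ≤ ε)
    (hπ : 6 * (P.d : ℝ) ^ 2 * (P.L : ℝ) ^ 2 * ε < π) :
    |argB (toC (uPrime U b))| ≤ 6 * (P.d : ℝ) ^ 2 * (P.L : ℝ) ^ 2 * ε := by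
  have hle : ((N₂ + N₃ : ℕ) : ℝ) ≤ 6 * (P.d : ℝ) ^ 2 * (P.L : ℝ) ^ 2 := by exact_mod_cast const_le_six
  have hle' := mul_le_mul_of_nonneg_right hle hε₀
  exact (abs_argB_uPrime_le hj hU hε₀ b hε (lt_of_le_of_lt hle' hπ)).trans hle'

/-- **The printed restriction feeds the phase hypothesis**: `|u(p) − 1| ≦ η` gives `|argB u(p)| ≤ (π/2)η`.
[cite: BalabanImbrieJaffe1988, (5.3.1) p.280] -/
theorem abs_argB_plaqHol_le_of_norm {U : GaugeField P j U1} {p : Balaban1983to89.Plaq P j} {η : ℝ}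
    (h : ‖toC (plaqHol U p) - 1‖ ≤ η) : |argB (toC (plaqHol U p))| ≤ π / 2 * η :=
  (abs_argB_le_norm_sub_one (norm_toC _)).trans (mul_le_mul_of_nonneg_left h (by positivity))

/-- **`u′_b = e^{ie_kA′_b}`**: with `A′_b := argB(u′_b)/e_k`, the translated field read in `ℂ` IS r16's parametrization
`BIJ88Sect5StatementsPart3.uPrime e_k A′` (p. 280 *"u′_b = e^{ie_kA′_b}"*). [cite: BalabanImbrieJaffe1988, (5.3.1) p.280] -/
theorem toC_uPrime_eq_uPrime531 {ek : ℝ} (hek : ek ≠ 0) (U : GaugeField P j U1) :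
    cfg (uPrime U) = BIJ88Sect5StatementsPart3.uPrime ek (fun b => argB (toC (uPrime U b)) / ek) := by
  funext b
  have e : ek * (argB (toC (uPrime U b)) / ek) = argB (toC (uPrime U b)) := by field_simp
  simp only [cfg, BIJ88Sect5StatementsPart3.uPrime, e]
  rw [mul_comm, exp_argB_mul_I_of_norm (norm_toC _)]

/-- **r16's asserted predicate `SmallAPrime` DISCHARGED** (row C2.Eq5.3.1-5.3.7): in the axial gauge, if every plaquette of the blocks
met by the bonds of `Λ₁*` (the block of `b` and the next one in the direction of `b` — inside `Λ₀^{(k)**}` in the paper's geometry)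
satisfies `|argB u(∂p)| ≤ e_kp(e_k)`, and `6d²L²e_kp(e_k) < π`, then `A′_b = argB(u′_b)/e_k` satisfies *"|A′_b| ≦ cp(e_k), for
b ∈ Λ₁^{(k)*}"* with `c = 6d²L²`. [cite: BalabanImbrieJaffe1988, (5.3.1) p.280] -/
theorem smallAPrime_of_plaquettes (hj : j + 1 ≤ P.m + P.K) {U : GaugeField P j U1} (hU : DeltaAx U) {ek pek : ℝ}
    (hek : 0 < ek) (hpek : 0 ≤ pek) (Λ1s : Finset (PBond P j))
    (hε : ∀ b ∈ Λ1s, ∀ p : Balaban1983to89.Plaq P j,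
      blockOf p.src = blockOf b.src ∨ blockOf p.src = (blockOf b.src).shift b.dir → |argB (toC (plaqHol U p))| ≤ ek * pek)
    (hπ : 6 * (P.d : ℝ) ^ 2 * (P.L : ℝ) ^ 2 * (ek * pek) < π) :
    BIJ88Sect5StatementsPart3.SmallAPrime (6 * (P.d : ℝ) ^ 2 * (P.L : ℝ) ^ 2) pek Λ1s
      (fun b => argB (toC (uPrime U b)) / ek) := by
  intro b hb
  have h := abs_argB_uPrime_le_six hj hU (mul_nonneg hek.le hpek) b (hε b hb) hπ
  dsimp only
  rw [abs_div, abs_of_pos hek, div_le_iff₀ hek]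
  calc |argB (toC (uPrime U b))| ≤ 6 * (P.d : ℝ) ^ 2 * (P.L : ℝ) ^ 2 * (ek * pek) := h
    _ = 6 * (P.d : ℝ) ^ 2 * (P.L : ℝ) ^ 2 * pek * ek := by ring

end

end Literature.MathematicalPhysics.QuantumFieldTheory.BalabanImbrieJaffe1984to88.BIJ88Eq531SmallAPrime
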